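import Mathlib.MeasureTheory.Integral.Bochner.Set
import Mathlib.MeasureTheory.Function.Jacobian
import Mathlib.MeasureTheory.Integral.Prod
import Mathlib.MeasureTheory.Integral.IntervalIntegral.FundThmCalculus
import Mathlib.GroupTheory.FreeAbelianGroup
import Mathlib.RingTheory.MvPolynomial.Tower
import Literature.NumberTheory.Transcendental.SemialgebraicMaps
import Literature.NumberTheory.Transcendental.KZCalculus
import HarnessLib

/-!
# The Kontsevich–Zagier calculus of moves over a coefficient ring `k ⊆ ℝ`

`Literature.NumberTheory.Transcendental.KZCalculus` fixes the Kontsevich–Zagier calculus of moves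
[KZ 2001, §1.2] with all domains, integrands, changes of variables and primitives
**`ℚ`-semialgebraic** (KZ: "rational may be replaced by algebraic", §1.1). This file is the same
calculus, verbatim, over an arbitrary *coefficient ring* `k` equipped with `[Algebra k ℝ]`
(`k = ℚ` is KZ's calculus; `k = ℝ` is the real-coefficient calculus `KZ_ℝ ⊇ KZ_ℚ`:
Cresson–Viu-Sos [CressonViusos2022, §1] define periods by semi-algebraic data "with coefficients
in `ℝ_alg`", stress that "the restriction over `ℝ_alg` on the coefficients plays a main role in this
theory and is one of the main obstructions", and recall [§2.2, Remark] that the classification of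
`ℝ`-semi-algebraic sets up to `ℝ`-semi-algebraic volume-preserving bijections was considered
intractable by Blass–Schanuel; intermediate rings `ℚ ⊆ k ⊆ ℝ` are the other case of interest):
every occurrence of `IsSemialgebraic ℚ`, `IsSemialgebraicFunOn ℚ`, `IsSemialgebraicMapOn ℚ` is
replaced by its `k`-version ([BochnakCosteRoy1998, Def. 2.1.4, Def. 2.2.5] with coefficients in
`k`), nothing else changes.

## Main definitions (namespace `Literature.NumberTheory.Transcendental.KZOver`)

* `KZOver.IntegralRep k n`, `IntegralRep.value`, `KZOver.FormalRep k`, `KZOver.of`, `KZOver.eval`;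
* the four move sets `KZOver.domainAddRel k`, `integrandAddRel k`, `changeOfVariablesRel k`,
  `newtonLeibnizRel k` (same side conditions as in `KZCalculus`, primitives / bounds / changes of
  variables `k`-semialgebraic), `KZOver.relations k`, `KZOver.Equivalent`;
* base change along a tower `k → k' → ℝ`: `IsSemialgebraic.baseChange` (and `FunOn`/`MapOn`
  versions), `IntegralRep.baseChange`, `KZOver.baseChange : FormalRep k →+ FormalRep k'`;
* identification with KZ's calculus at `k = ℚ`: `IntegralRep.equivKZ : KZ.IntegralRep n ≃ IntegralRep ℚ n`,
  `KZOver.equivKZ : KZ.FormalRep ≃+ FormalRep ℚ`;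
* the *raw encoding* over `ℝ` (namespace `KZOver.Raw`): the free abelian group on all pairs
  `(σ, f)`, admissibility `Raw.Adm`, generators `Raw.gen`, and the subgroup `Raw.Rel` generated by
  the four real-coefficient moves with admissibility as side conditions — these three definitions
  are, verbatim, the three `let`s `Adm` / `gen` / `Rel` by which route RealPeriodGerms of the
  Kontsevich–Zagier summit encodes `KZ_ℝ` inline — and `KZOver.toRaw : FormalRep ℝ →+ Raw group`.

## Main statements (all proved)

* soundness: `eval_eq_zero_of_mem_domainAddRel`, `…integrandAddRel`, `…changeOfVariablesRel`,
  `…newtonLeibnizRel`, `relations_le_ker_eval`, `Equivalent.value_eq` (the proofs of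
  `KZCalculus` §"Proofs of the soundness facts" go through unchanged);
* base change: `eval_baseChange`, `map_baseChange_relations_le`, `Equivalent.baseChange`;
* `k = ℚ`: `eval_equivKZ`, `map_equivKZ_relations : KZ.relations.map equivKZ = relations ℚ`,
  `equivKZ_mem_relations_iff`, `equivalent_ofKZ_iff : Equivalent (ofKZ r) (ofKZ r') ↔ KZ.Equivalent r r'`;
* raw comparison: `toRaw_injective`, `map_toRaw_relations : (relations ℝ).map toRaw = Raw.Rel`,
  `Raw.Rel_le_admissibleSpan`, `range_toRaw`, `mem_relations_iff_toRaw_mem`, and the comparison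
  lemma `Raw.gen_sub_gen_mem_Rel_iff : Raw.gen n σ f - Raw.gen m σ' f' ∈ Raw.Rel ↔
  of (ofAdm hσf) - of (ofAdm hσ'f') ∈ relations ℝ` for admissible pairs.

## References

* M. Kontsevich, D. Zagier, *Periods*, in: Mathematics Unlimited — 2001 and Beyond, Springer
  (2001), §§1.1–1.2.
* J. Cresson, J. Viu-Sos, *On the equality of periods of Kontsevich–Zagier*, J. Théor. Nombres
  Bordeaux 34 (2022), §1, §2.2.
* J. Bochnak, M. Coste, M.-F. Roy, *Real Algebraic Geometry* (1998), Def. 2.1.4, Def. 2.2.5.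
* A. Huber, S. Müller-Stach, *Periods and Nori Motives*, Springer (2017), §13.1.

## Design notes

* `k` is a `Type` with `[CommRing k] [Algebra k ℝ]` (not a `Subfield ℝ`), matching the signature of
  `Literature.ModelTheory.ExponentialFields.IsSemialgebraic`.
* `KZCalculus.lean` is untouched; `KZ.IntegralRep n` and `KZOver.IntegralRep ℚ n` carry literally
  the same data and `IntegralRep.equivKZ` is the tautological bijection (both round trips are `rfl`).
* In `KZCalculus` the soundness statements are named facts with `_holds` discharges (a migration
  artefact); here they are plain theorems.
* The raw encoding forgets the three proof fields of an `IntegralRep ℝ n`; `toRaw` is injective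
  (proof irrelevance) with image the span of the admissible generators, and carries `relations ℝ`
  onto `Raw.Rel` exactly (every generator of `Raw.Rel` has admissible entries), whence
  `c ∈ relations ℝ ↔ toRaw c ∈ Raw.Rel`.
* What is NOT here: the period-germ invariant of route RealPeriodGerms (a separate request), and
  the named facts of `KZCalculus` about rational shapes (`isRealPeriod_iff_exists_integralRep`,
  `exists_isRational_equivalent`, `exists_integralRep_sub`), which are statements about `k = ℚ`.
-/

noncomputable section

open MeasureTheory MvPolynomial Set
open Literature.ModelTheory.ExponentialFields (IsSemialgebraic)

/-! ### Base change of coefficients for semialgebraic sets, functions and maps -/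

namespace Literature.ModelTheory.ExponentialFields

section BaseChange

variable {k : Type*} (k' : Type*) {R : Type*} {ι : Type*} [CommRing k] [CommRing k'] [CommRing R]
  [LT R] [Algebra k R] [Algebra k' R] [Algebra k k'] [IsScalarTower k k' R]

/-- **Base change of coefficients along a tower `k → k' → R`.** A `k`-semialgebraic subset of
`R ^ ι` is `k'`-semialgebraic for every intermediate coefficient ring `k'` (`[IsScalarTower k k' R]`):
each generator `{p = 0}`, `{p > 0}` with `p ∈ k[X]` is the corresponding generator for the image of
`p` in `k'[X]` (`MvPolynomial.aeval_map_algebraMap`). Immediate from the definition; the case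
`k' = R` is `Literature.Barriers.KontsevichZagierPeriods.PL.isSemialgebraic_algebra_of_isSemialgebraic`.
(Declared in the namespace of `IsSemialgebraic` for dot notation.)
[Bochnak–Coste–Roy 1998, Def. 2.1.4] [cite: BochnakCosteRoy1998, Def. 2.1.4] -/
theorem IsSemialgebraic.baseChange {s : Set (ι → R)} (hs : IsSemialgebraic k s) :
    IsSemialgebraic k' s := by
  induction hs using BooleanSubalgebra.closure_bot_sup_induction with
  | mem t ht =>
    rcases ht with ⟨p, rfl⟩ | ⟨p, rfl⟩
    · convert isSemialgebraic_setOf_eval_eq_zero (k := k') (R := R)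
        (MvPolynomial.map (algebraMap k k') p) using 1
      ext x
      simp only [mem_setOf_eq, MvPolynomial.aeval_map_algebraMap]
    · convert isSemialgebraic_setOf_eval_pos (k := k') (R := R)
        (MvPolynomial.map (algebraMap k k') p) using 1
      ext x
      simp only [mem_setOf_eq, MvPolynomial.aeval_map_algebraMap]
  | bot => exact isSemialgebraic_empty
  | sup t _ u _ iht ihu => exact iht.union ihu
  | compl t _ iht => exact iht.compl

end BaseChange

end Literature.ModelTheory.ExponentialFields

namespace Literature.NumberTheory.Transcendental

section BaseChange

variable {k : Type*} (k' : Type*) {R : Type*} [CommRing k] [CommRing k'] [CommRing R] [LT R]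
  [Algebra k R] [Algebra k' R] [Algebra k k'] [IsScalarTower k k' R] {m n : ℕ}

/-- Base change of coefficients for semialgebraic functions: a function with `k`-semialgebraic
graph over `s` has `k'`-semialgebraic graph over `s`, for every tower `k → k' → R`.
[Bochnak–Coste–Roy 1998, Def. 2.2.5] [cite: BochnakCosteRoy1998, Def. 2.2.5] -/
theorem IsSemialgebraicFunOn.baseChange {s : Set (Fin m → R)} {f : (Fin m → R) → R}
    (hf : IsSemialgebraicFunOn k s f) : IsSemialgebraicFunOn k' s f :=
  Literature.ModelTheory.ExponentialFields.IsSemialgebraic.baseChange k' hf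

/-- Base change of coefficients for semialgebraic maps: a map with `k`-semialgebraic graph over
`s` has `k'`-semialgebraic graph over `s`, for every tower `k → k' → R`.
[Bochnak–Coste–Roy 1998, Def. 2.2.5] [cite: BochnakCosteRoy1998, Def. 2.2.5] -/
theorem IsSemialgebraicMapOn.baseChange {s : Set (Fin m → R)} {f : (Fin m → R) → (Fin n → R)}
    (hf : IsSemialgebraicMapOn k s f) : IsSemialgebraicMapOn k' s f :=
  Literature.ModelTheory.ExponentialFields.IsSemialgebraic.baseChange k' hf

end BaseChange

namespace KZOver

variable (k : Type*) [CommRing k] [Algebra k ℝ]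

/-- An *integral representation with coefficients in `k`*, in dimension `n`: a `k`-semialgebraic
domain `σ ⊆ ℝⁿ`, an integrand `f : ℝⁿ → ℝ` which is a `k`-semialgebraic function on `σ` (its graph
over `σ` is `k`-semialgebraic) and absolutely integrable on `σ` for Lebesgue measure. The represented
number is `IntegralRep.value r = ∫ x in σ, f x`. For `k = ℚ` this is literally
`Literature.NumberTheory.Transcendental.KZ.IntegralRep` (KZ: "rational may be replaced by
algebraic"); for `k = ℝ` it is the real-coefficient ("real semi-algebraic") datum of Cresson–Viu-Sos.
[Kontsevich–Zagier 2001, §1.1; Cresson–Viu-Sos 2022, §1] [cite: KontsevichZagier2001, §1.1] -/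
@[ext]
structure IntegralRep (n : ℕ) : Type where
  /-- The domain of integration `σ ⊆ ℝⁿ`. -/
  domain : Set (Fin n → ℝ)
  /-- The integrand (only its values on `domain` matter). -/
  integrand : (Fin n → ℝ) → ℝ
  /-- The domain is `k`-semialgebraic. -/
  isSemialgebraic_domain : IsSemialgebraic k domain
  /-- The integrand is a `k`-semialgebraic function on the domain. -/
  isSemialgebraicFunOn_integrand : IsSemialgebraicFunOn k domain integrand
  /-- The integral converges absolutely. -/
  integrableOn : IntegrableOn integrand domain

variable {k} {n m l : ℕ}

namespace IntegralRep

/-- The real number represented by an integral representation: `∫ x in σ, f x` (Lebesgue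
measure on `Fin n → ℝ`). [Kontsevich–Zagier 2001, §1.1] [cite: KontsevichZagier2001, §1.1] -/
def value (r : IntegralRep k n) : ℝ := ∫ x in r.domain, r.integrand x

/-- The domain of an integral representation is Lebesgue measurable (it is `k`-semialgebraic, hence
Borel: `IsSemialgebraic.measurableSet_holds`). [Kontsevich–Zagier 2001, §1.1] [cite: KontsevichZagier2001, §1.1] -/
theorem measurableSet_domain (r : IntegralRep k n) : MeasurableSet r.domain :=
  Literature.ModelTheory.ExponentialFields.IsSemialgebraic.measurableSet_holds r.isSemialgebraic_domain

end IntegralRep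

variable (k) in
/-- The free abelian group on all integral representations with coefficients in `k` (of all
dimensions): formal `ℤ`-linear combinations of integrals, on which the moves act.
[Kontsevich–Zagier 2001, §1.2; Huber–Müller-Stach 2017, §13.1] [cite: KontsevichZagier2001, §1.2] -/
abbrev FormalRep : Type := FreeAbelianGroup (Σ n, IntegralRep k n)

/-- The generator of `FormalRep k` attached to an integral representation.
[Kontsevich–Zagier 2001, §1.2] [cite: KontsevichZagier2001, §1.2] -/
def of (r : IntegralRep k n) : FormalRep k := FreeAbelianGroup.of ⟨n, r⟩

variable (k) in
/-- Evaluation of formal combinations of integral representations: the additive extension of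
`IntegralRep.value`. [Kontsevich–Zagier 2001, §1.2] [cite: KontsevichZagier2001, §1.2] -/
def eval : FormalRep k →+ ℝ := FreeAbelianGroup.lift fun r => r.2.value

/-- `eval` of a generator is the value of the representation. [Kontsevich–Zagier 2001, §1.2] [cite: KontsevichZagier2001, §1.2] -/
@[simp] theorem eval_of (r : IntegralRep k n) : eval k (of r) = r.value :=
  FreeAbelianGroup.lift_apply_of _ _

/-! ### The moves (verbatim from `KZCalculus`, coefficients `k`) -/

variable (k) in
/-- **Move (1a), additivity in the domain.** If `σ = σ₁ ∪ σ₂` with `σ₁ ∩ σ₂` Lebesgue-null and the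
integrands of `r₁`, `r₂` agree with that of `r` on their domains, then `[r] − [r₁] − [r₂]` is a
relation. [Kontsevich–Zagier 2001, §1.2, rule (1)] [cite: KontsevichZagier2001, §1.2 rule (1)] -/
def domainAddRel : Set (FormalRep k) :=
  {c | ∃ (n : ℕ) (r r₁ r₂ : IntegralRep k n), r.domain = r₁.domain ∪ r₂.domain ∧
    volume (r₁.domain ∩ r₂.domain) = 0 ∧ EqOn r.integrand r₁.integrand r₁.domain ∧
    EqOn r.integrand r₂.integrand r₂.domain ∧ c = of r - of r₁ - of r₂}

variable (k) in
/-- **Move (1b), additivity in the integrand.** If `r`, `r₁`, `r₂` have the same domain and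
`f = f₁ + f₂` on it, then `[r] − [r₁] − [r₂]` is a relation.
[Kontsevich–Zagier 2001, §1.2, rule (1)] [cite: KontsevichZagier2001, §1.2 rule (1)] -/
def integrandAddRel : Set (FormalRep k) :=
  {c | ∃ (n : ℕ) (r r₁ r₂ : IntegralRep k n), r₁.domain = r.domain ∧ r₂.domain = r.domain ∧
    EqOn r.integrand (r₁.integrand + r₂.integrand) r.domain ∧ c = of r - of r₁ - of r₂}

variable (k) in
/-- **Move (2), change of variables.** If `Φ` is a `k`-semialgebraic map on `σ = r.domain`,
injective on `σ`, with a derivative `Φ' x` within `σ` at every `x ∈ σ`, `r'.domain = Φ '' σ` and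
`f x = f' (Φ x) · |det Φ' x|` on `σ`, then `[r] − [r']` is a relation (exactly the hypotheses of
`MeasureTheory.integral_image_eq_integral_abs_det_fderiv_smul`).
[Kontsevich–Zagier 2001, §1.2, rule (2)] [cite: KontsevichZagier2001, §1.2 rule (2)] -/
def changeOfVariablesRel : Set (FormalRep k) :=
  {c | ∃ (n : ℕ) (r r' : IntegralRep k n) (Φ : (Fin n → ℝ) → (Fin n → ℝ))
      (Φ' : (Fin n → ℝ) → (Fin n → ℝ) →L[ℝ] (Fin n → ℝ)),
    IsSemialgebraicMapOn k r.domain Φ ∧ (∀ x ∈ r.domain, HasFDerivWithinAt Φ (Φ' x) r.domain x) ∧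
    InjOn Φ r.domain ∧ r'.domain = Φ '' r.domain ∧
    (∀ x ∈ r.domain, r.integrand x = r'.integrand (Φ x) * |(Φ' x).det|) ∧
    c = of r - of r'}

variable (k) in
/-- **Move (3), Newton–Leibniz along the last coordinate** (KZ's printed rule 3,
"`∫_a^b f'(x) dx = f(b) − f(a)`", read fibrewise over a semialgebraic base). Data: a base
representation `r'` in dimension `n` with domain `τ`, two `k`-semialgebraic functions `a ≤ b` on
`τ`, the band `r.domain = {(x, t) | x ∈ τ, a x ≤ t ≤ b x}`, and a primitive `F`, `k`-semialgebraic
on the band, continuous on each closed fibre and with derivative the integrand on each open fibre;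
if `r'.integrand x = F (x, b x) − F (x, a x)` on `τ`, then `[r] − [r']` is a relation.
[Kontsevich–Zagier 2001, §1.2, rule (3)] [cite: KontsevichZagier2001, §1.2 rule (3)] -/
def newtonLeibnizRel : Set (FormalRep k) :=
  {c | ∃ (n : ℕ) (r : IntegralRep k (n + 1)) (r' : IntegralRep k n) (a b : (Fin n → ℝ) → ℝ)
      (F : (Fin (n + 1) → ℝ) → ℝ),
    IsSemialgebraicFunOn k r.domain F ∧
    IsSemialgebraicFunOn k r'.domain a ∧ IsSemialgebraicFunOn k r'.domain b ∧
    (∀ x ∈ r'.domain, a x ≤ b x) ∧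
    r.domain = {z | (Fin.init z : Fin n → ℝ) ∈ r'.domain ∧ a (Fin.init z) ≤ z (Fin.last n) ∧
      z (Fin.last n) ≤ b (Fin.init z)} ∧
    (∀ x ∈ r'.domain, ContinuousOn (fun t : ℝ => F (Fin.snoc x t)) (Icc (a x) (b x))) ∧
    (∀ x ∈ r'.domain, ∀ t ∈ Ioo (a x) (b x),
      HasDerivAt (fun s : ℝ => F (Fin.snoc x s)) (r.integrand (Fin.snoc x t)) t) ∧
    (∀ x ∈ r'.domain, r'.integrand x = F (Fin.snoc x (b x)) - F (Fin.snoc x (a x))) ∧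
    c = of r - of r'}

variable (k) in
/-- The subgroup of relations of the calculus over `k`: generated by the four moves.
[Kontsevich–Zagier 2001, §1.2; Huber–Müller-Stach 2017, §13.1] [cite: KontsevichZagier2001, §1.2] -/
def relations : AddSubgroup (FormalRep k) :=
  AddSubgroup.closure
    (domainAddRel k ∪ integrandAddRel k ∪ changeOfVariablesRel k ∪ newtonLeibnizRel k)

/-- Two integral representations (possibly of different dimensions) are *equivalent over `k`* if
`[r] − [r'] ∈ relations k`. [Kontsevich–Zagier 2001, §1.2] [cite: KontsevichZagier2001, §1.2] -/
def Equivalent (r : IntegralRep k n) (r' : IntegralRep k m) : Prop := of r - of r' ∈ relations k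

/-- The domain-additivity move is a relation. [Kontsevich–Zagier 2001, §1.2] [cite: KontsevichZagier2001, §1.2] -/
lemma domainAddRel_subset_relations : domainAddRel k ⊆ relations k := fun _ hc =>
  AddSubgroup.subset_closure (Or.inl (Or.inl (Or.inl hc)))

/-- The integrand-additivity move is a relation. [Kontsevich–Zagier 2001, §1.2] [cite: KontsevichZagier2001, §1.2] -/
lemma integrandAddRel_subset_relations : integrandAddRel k ⊆ relations k := fun _ hc =>
  AddSubgroup.subset_closure (Or.inl (Or.inl (Or.inr hc)))

/-- The change-of-variables move is a relation. [Kontsevich–Zagier 2001, §1.2] [cite: KontsevichZagier2001, §1.2] -/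
lemma changeOfVariablesRel_subset_relations : changeOfVariablesRel k ⊆ relations k := fun _ hc =>
  AddSubgroup.subset_closure (Or.inl (Or.inr hc))

/-- The Newton–Leibniz move is a relation. [Kontsevich–Zagier 2001, §1.2] [cite: KontsevichZagier2001, §1.2] -/
lemma newtonLeibnizRel_subset_relations : newtonLeibnizRel k ⊆ relations k := fun _ hc =>
  AddSubgroup.subset_closure (Or.inr hc)

namespace Equivalent

/-- Equivalence of representations is reflexive. [Kontsevich–Zagier 2001, §1.2] [cite: KontsevichZagier2001, §1.2] -/
@[refl] protected theorem refl (r : IntegralRep k n) : Equivalent r r := by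
  simp [Equivalent, (relations k).zero_mem]

/-- Equivalence of representations is symmetric. [Kontsevich–Zagier 2001, §1.2] [cite: KontsevichZagier2001, §1.2] -/
@[symm] protected theorem symm {r : IntegralRep k n} {r' : IntegralRep k m} (h : Equivalent r r') :
    Equivalent r' r := by
  simpa [Equivalent] using (relations k).neg_mem h

/-- Equivalence of representations is transitive. [Kontsevich–Zagier 2001, §1.2] [cite: KontsevichZagier2001, §1.2] -/
@[trans] protected theorem trans {r : IntegralRep k n} {r' : IntegralRep k m}
    {r'' : IntegralRep k l} (h : Equivalent r r') (h' : Equivalent r' r'') : Equivalent r r'' := by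
  simpa [Equivalent] using (relations k).add_mem h h'

end Equivalent

/-! ### Soundness of the moves (the proofs of `KZCalculus`, unchanged) -/

/-- Soundness of domain additivity: `∫_{σ₁ ∪ σ₂} f = ∫_{σ₁} f + ∫_{σ₂} f` when `σ₁ ∩ σ₂` is null
(`MeasureTheory.setIntegral_union₀`). [Kontsevich–Zagier 2001, §1.2, rule (1)] [cite: KontsevichZagier2001, §1.2 rule (1)] -/
theorem eval_eq_zero_of_mem_domainAddRel {c : FormalRep k} (hc : c ∈ domainAddRel k) :
    eval k c = 0 := by
  obtain ⟨n, r, r₁, r₂, hdom, hnull, h₁, h₂, rfl⟩ := hc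
  simp only [map_sub, eval_of, IntegralRep.value]
  rw [sub_sub, sub_eq_zero]
  have hae : AEDisjoint volume r₁.domain r₂.domain := hnull
  rw [hdom, setIntegral_union₀ hae r₂.measurableSet_domain.nullMeasurableSet
    (hdom ▸ r.integrableOn).left_of_union (hdom ▸ r.integrableOn).right_of_union,
    setIntegral_congr_fun r₁.measurableSet_domain h₁,
    setIntegral_congr_fun r₂.measurableSet_domain h₂]

/-- Soundness of integrand additivity: `∫_σ (f₁ + f₂) = ∫_σ f₁ + ∫_σ f₂` for integrable `fᵢ`
(`MeasureTheory.integral_add`). [Kontsevich–Zagier 2001, §1.2, rule (1)] [cite: KontsevichZagier2001, §1.2 rule (1)] -/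
theorem eval_eq_zero_of_mem_integrandAddRel {c : FormalRep k} (hc : c ∈ integrandAddRel k) :
    eval k c = 0 := by
  obtain ⟨n, r, r₁, r₂, h₁, h₂, hadd, rfl⟩ := hc
  simp only [map_sub, eval_of, IntegralRep.value]
  rw [sub_sub, sub_eq_zero]
  rw [setIntegral_congr_fun r.measurableSet_domain hadd, h₁, h₂]
  exact integral_add (h₁ ▸ r₁.integrableOn) (h₂ ▸ r₂.integrableOn)

/-- Soundness of change of variables, from Mathlib's Jacobian formula
`MeasureTheory.integral_image_eq_integral_abs_det_fderiv_smul`.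
[Kontsevich–Zagier 2001, §1.2, rule (2)] [cite: KontsevichZagier2001, §1.2 rule (2)] -/
theorem eval_eq_zero_of_mem_changeOfVariablesRel {c : FormalRep k}
    (hc : c ∈ changeOfVariablesRel k) : eval k c = 0 := by
  obtain ⟨n, r, r', Φ, Φ', -, hΦ', hinj, hdom, hf, rfl⟩ := hc
  simp only [map_sub, eval_of, IntegralRep.value, sub_eq_zero]
  rw [hdom, integral_image_eq_integral_abs_det_fderiv_smul volume r.measurableSet_domain hΦ' hinj,
    setIntegral_congr_fun r.measurableSet_domain hf]
  simp [smul_eq_mul, mul_comm]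

/-- Soundness of the Newton–Leibniz move: identify `ℝⁿ⁺¹` with `ℝ × ℝⁿ` by the volume-preserving
`MeasurableEquiv.piFinSuccAbove _ (Fin.last n)`, extend the integrand by zero off the band, apply
Fubini (`MeasureTheory.integral_prod_symm`), and on each fibre over `x ∈ τ` the fundamental theorem
of calculus `intervalIntegral.integral_eq_sub_of_hasDerivAt_of_le` (the derivative being integrable
on a.e. fibre, `Integrable.prod_left_ae`); fibres over `x ∉ τ` vanish.
[Kontsevich–Zagier 2001, §1.2, rule (3)] [cite: KontsevichZagier2001, §1.2 rule (3)] -/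
theorem eval_eq_zero_of_mem_newtonLeibnizRel {c : FormalRep k} (hc : c ∈ newtonLeibnizRel k) :
    eval k c = 0 := by
  obtain ⟨n, r, r', a, b, F, -, -, -, hab, hdom, hcont, hderiv, hr', rfl⟩ := hc
  simp only [map_sub, eval_of, IntegralRep.value, sub_eq_zero]
  have hτm : MeasurableSet r'.domain := r'.measurableSet_domain
  have hbm : MeasurableSet r.domain := r.measurableSet_domain
  -- split off the last coordinate
  set e : (Fin (n + 1) → ℝ) ≃ᵐ ℝ × (Fin n → ℝ) :=
    MeasurableEquiv.piFinSuccAbove (fun _ => ℝ) (Fin.last n) with he_def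
  have he : MeasurePreserving e volume volume :=
    volume_preserving_piFinSuccAbove (fun _ => ℝ) (Fin.last n)
  have he_symm : ∀ p : ℝ × (Fin n → ℝ), e.symm p = Fin.snoc p.2 p.1 := fun p => by
    simp [he_def, MeasurableEquiv.piFinSuccAbove, Fin.snocEquiv]
  -- membership in the band, fibrewise
  have hmem : ∀ x t, Fin.snoc x t ∈ r.domain ↔ x ∈ r'.domain ∧ t ∈ Icc (a x) (b x) := by
    intro x t
    rw [hdom]
    simp only [mem_setOf_eq, Fin.init_snoc, Fin.snoc_last, mem_Icc]
  -- the integrand extended by zero off the band, and its fibres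
  set G : (Fin (n + 1) → ℝ) → ℝ := r.domain.indicator r.integrand with hG_def
  have hG : Integrable G := (integrable_indicator_iff hbm).mpr r.integrableOn
  have hfib_in : ∀ x ∈ r'.domain, (fun t => G (Fin.snoc x t)) =
      (Icc (a x) (b x)).indicator (fun t => r.integrand (Fin.snoc x t)) := by
    intro x hx
    ext t
    by_cases ht : t ∈ Icc (a x) (b x)
    · rw [Set.indicator_of_mem ht, hG_def, Set.indicator_of_mem ((hmem x t).2 ⟨hx, ht⟩)]
    · rw [Set.indicator_of_notMem ht, hG_def,
        Set.indicator_of_notMem (fun h => ht ((hmem x t).1 h).2)]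
  have hfib_out : ∀ x ∉ r'.domain, (fun t => G (Fin.snoc x t)) = fun _ => 0 := by
    intro x hx
    ext t
    rw [hG_def, Set.indicator_of_notMem (fun h => hx ((hmem x t).1 h).1)]
  have hG2 : Integrable (fun p : ℝ × (Fin n → ℝ) => G (Fin.snoc p.2 p.1))
      ((volume : Measure ℝ).prod (volume : Measure (Fin n → ℝ))) := by
    have h := ((he.symm e).integrable_comp_emb e.symm.measurableEmbedding (g := G)).mpr hG
    rw [← Measure.volume_eq_prod]
    convert h using 1
    ext p
    simp [he_symm]
  calc ∫ z in r.domain, r.integrand z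
      = ∫ z, G z := (integral_indicator hbm).symm
    _ = ∫ p, G (e.symm p) := ((he.symm e).integral_comp' G).symm
    _ = ∫ p : ℝ × (Fin n → ℝ), G (Fin.snoc p.2 p.1) ∂(volume.prod volume) := by
        simp_rw [he_symm, Measure.volume_eq_prod]
    _ = ∫ x, ∫ t, G (Fin.snoc x t) := integral_prod_symm _ hG2
    _ = ∫ x, r'.domain.indicator
          (fun x => F (Fin.snoc x (b x)) - F (Fin.snoc x (a x))) x := by
        apply integral_congr_ae
        filter_upwards [hG2.prod_left_ae] with x hx
        by_cases hxτ : x ∈ r'.domain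
        · rw [Set.indicator_of_mem hxτ, hfib_in x hxτ, integral_indicator measurableSet_Icc,
            integral_Icc_eq_integral_Ioc, ← intervalIntegral.integral_of_le (hab x hxτ)]
          apply intervalIntegral.integral_eq_sub_of_hasDerivAt_of_le (hab x hxτ) (hcont x hxτ)
            (hderiv x hxτ)
          rw [intervalIntegrable_iff_integrableOn_Icc_of_le (hab x hxτ)]
          have hx' : Integrable (fun t => G (Fin.snoc x t)) := hx
          rw [hfib_in x hxτ] at hx'
          exact (integrable_indicator_iff measurableSet_Icc).mp hx'
        · rw [Set.indicator_of_notMem hxτ]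
          rw [hfib_out x hxτ, integral_zero]
    _ = ∫ x in r'.domain, (F (Fin.snoc x (b x)) - F (Fin.snoc x (a x))) :=
        integral_indicator hτm
    _ = ∫ x in r'.domain, r'.integrand x := (setIntegral_congr_fun hτm fun x hx => hr' x hx).symm

variable (k) in
/-- **Soundness of the calculus over `k`**: the subgroup generated by the four moves lies in the
kernel of evaluation. [Kontsevich–Zagier 2001, §1.2; Huber–Müller-Stach 2017, §13.1] [cite: KontsevichZagier2001, §1.2] -/
theorem relations_le_ker_eval : relations k ≤ (eval k).ker := by
  refine (AddSubgroup.closure_le _).mpr ?_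
  rintro c (((hc | hc) | hc) | hc)
  · exact eval_eq_zero_of_mem_domainAddRel hc
  · exact eval_eq_zero_of_mem_integrandAddRel hc
  · exact eval_eq_zero_of_mem_changeOfVariablesRel hc
  · exact eval_eq_zero_of_mem_newtonLeibnizRel hc

/-- `eval` vanishes on relations. [Kontsevich–Zagier 2001, §1.2] [cite: KontsevichZagier2001, §1.2] -/
theorem eval_eq_zero_of_mem_relations {c : FormalRep k} (hc : c ∈ relations k) : eval k c = 0 :=
  relations_le_ker_eval k hc

/-- Equivalent representations represent the same number. [Kontsevich–Zagier 2001, §1.2] [cite: KontsevichZagier2001, §1.2] -/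
theorem Equivalent.value_eq {r : IntegralRep k n} {r' : IntegralRep k m} (h : Equivalent r r') :
    r.value = r'.value := by
  have := relations_le_ker_eval k h
  rwa [AddMonoidHom.mem_ker, map_sub, eval_of, eval_of, sub_eq_zero] at this

/-! ### Constructions of representations -/

namespace IntegralRep

/-- Restriction of an integral representation to a `k`-semialgebraic subdomain.
[Kontsevich–Zagier 2001, §1.2] [cite: KontsevichZagier2001, §1.2] -/
def restrict (r : IntegralRep k n) (s : Set (Fin n → ℝ)) (hs : IsSemialgebraic k s)
    (hsr : s ⊆ r.domain) : IntegralRep k n where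
  domain := s
  integrand := r.integrand
  isSemialgebraic_domain := hs
  isSemialgebraicFunOn_integrand := r.isSemialgebraicFunOn_integrand.mono hsr hs
  integrableOn := r.integrableOn.mono_set hsr

/-- The domain of a restricted representation. [Kontsevich–Zagier 2001, §1.2] [cite: KontsevichZagier2001, §1.2] -/
@[simp] lemma domain_restrict (r : IntegralRep k n) (s : Set (Fin n → ℝ)) (hs : IsSemialgebraic k s)
    (hsr : s ⊆ r.domain) : (r.restrict s hs hsr).domain = s := rfl

/-- The integrand of a restricted representation. [Kontsevich–Zagier 2001, §1.2] [cite: KontsevichZagier2001, §1.2] -/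
@[simp] lemma integrand_restrict (r : IntegralRep k n) (s : Set (Fin n → ℝ))
    (hs : IsSemialgebraic k s) (hsr : s ⊆ r.domain) :
    (r.restrict s hs hsr).integrand = r.integrand := rfl

/-- The negative of an integral representation (same domain, opposite integrand).
[Kontsevich–Zagier 2001, §1.1 (periods form a ring)] [cite: KontsevichZagier2001, §1.1] -/
def neg (r : IntegralRep k n) : IntegralRep k n where
  domain := r.domain
  integrand := -r.integrand
  isSemialgebraic_domain := r.isSemialgebraic_domain
  isSemialgebraicFunOn_integrand := r.isSemialgebraicFunOn_integrand.neg
  integrableOn := r.integrableOn.neg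

/-- The domain of the negative representation. [Kontsevich–Zagier 2001, §1.1] [cite: KontsevichZagier2001, §1.1] -/
@[simp] lemma domain_neg (r : IntegralRep k n) : r.neg.domain = r.domain := rfl

/-- The integrand of the negative representation. [Kontsevich–Zagier 2001, §1.1] [cite: KontsevichZagier2001, §1.1] -/
@[simp] lemma integrand_neg (r : IntegralRep k n) : r.neg.integrand = -r.integrand := rfl

/-- The value of the negative representation is the negative of the value.
[Kontsevich–Zagier 2001, §1.1] [cite: KontsevichZagier2001, §1.1] -/
@[simp] theorem value_neg (r : IntegralRep k n) : r.neg.value = -r.value := by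
  simp [value, neg, integral_neg]

end IntegralRep

/-! ### Base change along a tower `k → k' → ℝ` -/

section BaseChange

variable (k' : Type*) [CommRing k'] [Algebra k' ℝ] [Algebra k k'] [IsScalarTower k k' ℝ]

namespace IntegralRep

/-- Base change of an integral representation along `k → k'`: same domain and integrand, the
`k`-semialgebraic data being `k'`-semialgebraic (`IsSemialgebraic.baseChange`). With `k' = ℝ`
this is the inclusion `KZ_k ⊆ KZ_ℝ`. [Kontsevich–Zagier 2001, §1.1; Cresson–Viu-Sos 2022, §1] [cite: KontsevichZagier2001, §1.1] -/
def baseChange (r : IntegralRep k n) : IntegralRep k' n where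
  domain := r.domain
  integrand := r.integrand
  isSemialgebraic_domain := r.isSemialgebraic_domain.baseChange k'
  isSemialgebraicFunOn_integrand := r.isSemialgebraicFunOn_integrand.baseChange k'
  integrableOn := r.integrableOn

/-- Base change does not change the domain. [Kontsevich–Zagier 2001, §1.1] [cite: KontsevichZagier2001, §1.1] -/
@[simp] lemma domain_baseChange (r : IntegralRep k n) : (r.baseChange k').domain = r.domain := rfl

/-- Base change does not change the integrand. [Kontsevich–Zagier 2001, §1.1] [cite: KontsevichZagier2001, §1.1] -/
@[simp] lemma integrand_baseChange (r : IntegralRep k n) :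
    (r.baseChange k').integrand = r.integrand := rfl

/-- Base change does not change the value. [Kontsevich–Zagier 2001, §1.1] [cite: KontsevichZagier2001, §1.1] -/
@[simp] theorem value_baseChange (r : IntegralRep k n) : (r.baseChange k').value = r.value := rfl

end IntegralRep

variable (k) in
/-- Base change of formal combinations along `k → k'`: the additive map `FormalRep k →+ FormalRep k'`
induced by `IntegralRep.baseChange` on generators. [Kontsevich–Zagier 2001, §1.2] [cite: KontsevichZagier2001, §1.2] -/
def baseChange : FormalRep k →+ FormalRep k' :=
  FreeAbelianGroup.map fun r => ⟨r.1, r.2.baseChange k'⟩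

/-- Base change of a generator. [Kontsevich–Zagier 2001, §1.2] [cite: KontsevichZagier2001, §1.2] -/
@[simp] theorem baseChange_of (r : IntegralRep k n) :
    baseChange k k' (of r) = of (r.baseChange k') := rfl

/-- Base change commutes with evaluation. [Kontsevich–Zagier 2001, §1.2] [cite: KontsevichZagier2001, §1.2] -/
@[simp] theorem eval_baseChange (c : FormalRep k) : eval k' (baseChange k k' c) = eval k c := by
  have h : (eval k').comp (baseChange k k') = eval k :=
    FreeAbelianGroup.lift_ext _ _ fun ⟨n, r⟩ => by
      simp only [AddMonoidHom.coe_comp, Function.comp_apply]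
      exact (baseChange_of k' r ▸ eval_of (r.baseChange k')).trans (eval_of r).symm
  exact DFunLike.congr_fun h c

/-- Base change maps the domain-additivity move into the domain-additivity move.
[Kontsevich–Zagier 2001, §1.2] [cite: KontsevichZagier2001, §1.2] -/
theorem baseChange_mem_domainAddRel {c : FormalRep k} (hc : c ∈ domainAddRel k) :
    baseChange k k' c ∈ domainAddRel k' := by
  obtain ⟨n, r, r₁, r₂, hdom, hnull, h₁, h₂, rfl⟩ := hc
  exact ⟨n, r.baseChange k', r₁.baseChange k', r₂.baseChange k', hdom, hnull, h₁, h₂,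
    by simp only [map_sub, baseChange_of]⟩

/-- Base change maps the integrand-additivity move into the integrand-additivity move.
[Kontsevich–Zagier 2001, §1.2] [cite: KontsevichZagier2001, §1.2] -/
theorem baseChange_mem_integrandAddRel {c : FormalRep k} (hc : c ∈ integrandAddRel k) :
    baseChange k k' c ∈ integrandAddRel k' := by
  obtain ⟨n, r, r₁, r₂, h₁, h₂, hadd, rfl⟩ := hc
  exact ⟨n, r.baseChange k', r₁.baseChange k', r₂.baseChange k', h₁, h₂, hadd,
    by simp only [map_sub, baseChange_of]⟩

/-- Base change maps the change-of-variables move into the change-of-variables move (a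
`k`-semialgebraic change of variables is `k'`-semialgebraic). [Kontsevich–Zagier 2001, §1.2] [cite: KontsevichZagier2001, §1.2] -/
theorem baseChange_mem_changeOfVariablesRel {c : FormalRep k} (hc : c ∈ changeOfVariablesRel k) :
    baseChange k k' c ∈ changeOfVariablesRel k' := by
  obtain ⟨n, r, r', Φ, Φ', hΦ, hΦ', hinj, hdom, hf, rfl⟩ := hc
  exact ⟨n, r.baseChange k', r'.baseChange k', Φ, Φ', hΦ.baseChange k', hΦ', hinj, hdom, hf,
    by simp only [map_sub, baseChange_of]⟩

/-- Base change maps the Newton–Leibniz move into the Newton–Leibniz move (primitive and bounds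
being `k'`-semialgebraic). [Kontsevich–Zagier 2001, §1.2] [cite: KontsevichZagier2001, §1.2] -/
theorem baseChange_mem_newtonLeibnizRel {c : FormalRep k} (hc : c ∈ newtonLeibnizRel k) :
    baseChange k k' c ∈ newtonLeibnizRel k' := by
  obtain ⟨n, r, r', a, b, F, hF, ha, hb, hab, hdom, hcont, hderiv, hr', rfl⟩ := hc
  exact ⟨n, r.baseChange k', r'.baseChange k', a, b, F, hF.baseChange k', ha.baseChange k',
    hb.baseChange k', hab, hdom, hcont, hderiv, hr', by simp only [map_sub, baseChange_of]⟩

variable (k) in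
/-- Base change maps relations over `k` into relations over `k'`: `KZ_k`-certificates are
`KZ_{k'}`-certificates. [Kontsevich–Zagier 2001, §1.2; Cresson–Viu-Sos 2022, §1] [cite: KontsevichZagier2001, §1.2] -/
theorem map_baseChange_relations_le : (relations k).map (baseChange k k') ≤ relations k' := by
  rw [relations, AddMonoidHom.map_closure]
  refine (AddSubgroup.closure_le _).mpr ?_
  rintro _ ⟨c, (((hc | hc) | hc) | hc), rfl⟩
  · exact domainAddRel_subset_relations (baseChange_mem_domainAddRel k' hc)
  · exact integrandAddRel_subset_relations (baseChange_mem_integrandAddRel k' hc)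
  · exact changeOfVariablesRel_subset_relations (baseChange_mem_changeOfVariablesRel k' hc)
  · exact newtonLeibnizRel_subset_relations (baseChange_mem_newtonLeibnizRel k' hc)

/-- Base change maps relations into relations (elementwise form).
[Kontsevich–Zagier 2001, §1.2] [cite: KontsevichZagier2001, §1.2] -/
theorem baseChange_mem_relations {c : FormalRep k} (hc : c ∈ relations k) :
    baseChange k k' c ∈ relations k' :=
  map_baseChange_relations_le k k' (AddSubgroup.mem_map_of_mem _ hc)

/-- Equivalent representations over `k` stay equivalent over `k'`.
[Kontsevich–Zagier 2001, §1.2] [cite: KontsevichZagier2001, §1.2] -/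
theorem Equivalent.baseChange {r : IntegralRep k n} {r' : IntegralRep k m} (h : Equivalent r r') :
    Equivalent (r.baseChange k') (r'.baseChange k') := by
  simpa only [Equivalent, map_sub, baseChange_of] using baseChange_mem_relations k' h

end BaseChange

/-! ### The case `k = ℚ`: identification with `KZCalculus` -/

namespace IntegralRep

/-- A KZ integral representation (`ℚ`-semialgebraic data, file `KZCalculus`) as an integral
representation with coefficients in `ℚ`: the same five fields. [Kontsevich–Zagier 2001, §1.1] [cite: KontsevichZagier2001, §1.1] -/
def ofKZ (r : KZ.IntegralRep n) : IntegralRep ℚ n :=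
  ⟨r.domain, r.integrand, r.isSemialgebraic_domain, r.isSemialgebraicFunOn_integrand, r.integrableOn⟩

/-- An integral representation with coefficients in `ℚ` as a KZ integral representation: the same
five fields. [Kontsevich–Zagier 2001, §1.1] [cite: KontsevichZagier2001, §1.1] -/
def toKZ (r : IntegralRep ℚ n) : KZ.IntegralRep n :=
  ⟨r.domain, r.integrand, r.isSemialgebraic_domain, r.isSemialgebraicFunOn_integrand, r.integrableOn⟩

/-- `ofKZ` keeps the domain. [Kontsevich–Zagier 2001, §1.1] [cite: KontsevichZagier2001, §1.1] -/
@[simp] lemma domain_ofKZ (r : KZ.IntegralRep n) : (ofKZ r).domain = r.domain := rfl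

/-- `ofKZ` keeps the integrand. [Kontsevich–Zagier 2001, §1.1] [cite: KontsevichZagier2001, §1.1] -/
@[simp] lemma integrand_ofKZ (r : KZ.IntegralRep n) : (ofKZ r).integrand = r.integrand := rfl

/-- `toKZ` keeps the domain. [Kontsevich–Zagier 2001, §1.1] [cite: KontsevichZagier2001, §1.1] -/
@[simp] lemma domain_toKZ (r : IntegralRep ℚ n) : (toKZ r).domain = r.domain := rfl

/-- `toKZ` keeps the integrand. [Kontsevich–Zagier 2001, §1.1] [cite: KontsevichZagier2001, §1.1] -/
@[simp] lemma integrand_toKZ (r : IntegralRep ℚ n) : (toKZ r).integrand = r.integrand := rfl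

/-- `ofKZ` keeps the value. [Kontsevich–Zagier 2001, §1.1] [cite: KontsevichZagier2001, §1.1] -/
@[simp] theorem value_ofKZ (r : KZ.IntegralRep n) : (ofKZ r).value = r.value := rfl

/-- **`KZ.IntegralRep n ≃ KZOver.IntegralRep ℚ n`**: KZ's integral representations are exactly the
integral representations with coefficients in `ℚ` (tautological; both round trips are `rfl`).
[Kontsevich–Zagier 2001, §1.1] [cite: KontsevichZagier2001, §1.1] -/
def equivKZ : KZ.IntegralRep n ≃ IntegralRep ℚ n where
  toFun := ofKZ
  invFun := toKZ
  left_inv _ := rfl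
  right_inv _ := rfl

/-- `equivKZ` is `ofKZ`. [Kontsevich–Zagier 2001, §1.1] [cite: KontsevichZagier2001, §1.1] -/
@[simp] lemma equivKZ_apply (r : KZ.IntegralRep n) : equivKZ r = ofKZ r := rfl

/-- `equivKZ.symm` is `toKZ`. [Kontsevich–Zagier 2001, §1.1] [cite: KontsevichZagier2001, §1.1] -/
@[simp] lemma equivKZ_symm_apply (r : IntegralRep ℚ n) : equivKZ.symm r = toKZ r := rfl

end IntegralRep

/-- **`KZ.FormalRep ≃+ KZOver.FormalRep ℚ`**, induced by `IntegralRep.equivKZ` on generators.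
[Kontsevich–Zagier 2001, §1.2] [cite: KontsevichZagier2001, §1.2] -/
def equivKZ : KZ.FormalRep ≃+ FormalRep ℚ :=
  FreeAbelianGroup.equivOfEquiv (Equiv.sigmaCongrRight fun _ => IntegralRep.equivKZ)

/-- `equivKZ` on a generator. [Kontsevich–Zagier 2001, §1.2] [cite: KontsevichZagier2001, §1.2] -/
@[simp] theorem equivKZ_of (r : KZ.IntegralRep n) : equivKZ (KZ.of r) = of (IntegralRep.ofKZ r) :=
  rfl

/-- `equivKZ.symm` on a generator. [Kontsevich–Zagier 2001, §1.2] [cite: KontsevichZagier2001, §1.2] -/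
@[simp] theorem equivKZ_symm_of (r : IntegralRep ℚ n) :
    equivKZ.symm (of r) = KZ.of (IntegralRep.toKZ r) :=
  rfl

/-- `equivKZ` commutes with evaluation. [Kontsevich–Zagier 2001, §1.2] [cite: KontsevichZagier2001, §1.2] -/
@[simp] theorem eval_equivKZ (c : KZ.FormalRep) : eval ℚ (equivKZ c) = KZ.eval c := by
  have h : (eval ℚ).comp equivKZ.toAddMonoidHom = KZ.eval :=
    FreeAbelianGroup.lift_ext _ _ fun ⟨n, r⟩ => by
      simp only [AddMonoidHom.coe_comp, Function.comp_apply, AddEquiv.coe_toAddMonoidHom]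
      exact (eval_of (IntegralRep.ofKZ r)).trans (KZ.eval_of r).symm
  exact DFunLike.congr_fun h c

/-- `equivKZ` carries KZ's domain-additivity move onto the domain-additivity move over `ℚ`.
[Kontsevich–Zagier 2001, §1.2] [cite: KontsevichZagier2001, §1.2] -/
theorem image_equivKZ_domainAddRel : equivKZ '' KZ.domainAddRel = domainAddRel ℚ := by
  ext c
  constructor
  · rintro ⟨_, ⟨n, r, r₁, r₂, hdom, hnull, h₁, h₂, rfl⟩, rfl⟩
    exact ⟨n, .ofKZ r, .ofKZ r₁, .ofKZ r₂, hdom, hnull, h₁, h₂, by simp only [map_sub, equivKZ_of]⟩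
  · rintro ⟨n, r, r₁, r₂, hdom, hnull, h₁, h₂, rfl⟩
    exact ⟨KZ.of r.toKZ - KZ.of r₁.toKZ - KZ.of r₂.toKZ,
      ⟨n, r.toKZ, r₁.toKZ, r₂.toKZ, hdom, hnull, h₁, h₂, rfl⟩, by simp only [map_sub, equivKZ_of]; rfl⟩

/-- `equivKZ` carries KZ's integrand-additivity move onto the integrand-additivity move over `ℚ`.
[Kontsevich–Zagier 2001, §1.2] [cite: KontsevichZagier2001, §1.2] -/
theorem image_equivKZ_integrandAddRel : equivKZ '' KZ.integrandAddRel = integrandAddRel ℚ := by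
  ext c
  constructor
  · rintro ⟨_, ⟨n, r, r₁, r₂, h₁, h₂, hadd, rfl⟩, rfl⟩
    exact ⟨n, .ofKZ r, .ofKZ r₁, .ofKZ r₂, h₁, h₂, hadd, by simp only [map_sub, equivKZ_of]⟩
  · rintro ⟨n, r, r₁, r₂, h₁, h₂, hadd, rfl⟩
    exact ⟨KZ.of r.toKZ - KZ.of r₁.toKZ - KZ.of r₂.toKZ,
      ⟨n, r.toKZ, r₁.toKZ, r₂.toKZ, h₁, h₂, hadd, rfl⟩, by simp only [map_sub, equivKZ_of]; rfl⟩

/-- `equivKZ` carries KZ's change-of-variables move onto the change-of-variables move over `ℚ`.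
[Kontsevich–Zagier 2001, §1.2] [cite: KontsevichZagier2001, §1.2] -/
theorem image_equivKZ_changeOfVariablesRel :
    equivKZ '' KZ.changeOfVariablesRel = changeOfVariablesRel ℚ := by
  ext c
  constructor
  · rintro ⟨_, ⟨n, r, r', Φ, Φ', hΦ, hΦ', hinj, hdom, hf, rfl⟩, rfl⟩
    exact ⟨n, .ofKZ r, .ofKZ r', Φ, Φ', hΦ, hΦ', hinj, hdom, hf, by simp only [map_sub, equivKZ_of]⟩
  · rintro ⟨n, r, r', Φ, Φ', hΦ, hΦ', hinj, hdom, hf, rfl⟩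
    exact ⟨KZ.of r.toKZ - KZ.of r'.toKZ, ⟨n, r.toKZ, r'.toKZ, Φ, Φ', hΦ, hΦ', hinj, hdom, hf, rfl⟩,
      by simp only [map_sub, equivKZ_of]; rfl⟩

/-- `equivKZ` carries KZ's Newton–Leibniz move onto the Newton–Leibniz move over `ℚ`.
[Kontsevich–Zagier 2001, §1.2] [cite: KontsevichZagier2001, §1.2] -/
theorem image_equivKZ_newtonLeibnizRel : equivKZ '' KZ.newtonLeibnizRel = newtonLeibnizRel ℚ := by
  ext c
  constructor
  · rintro ⟨_, ⟨n, r, r', a, b, F, hF, ha, hb, hab, hdom, hcont, hderiv, hr', rfl⟩, rfl⟩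
    exact ⟨n, .ofKZ r, .ofKZ r', a, b, F, hF, ha, hb, hab, hdom, hcont, hderiv, hr',
      by simp only [map_sub, equivKZ_of]⟩
  · rintro ⟨n, r, r', a, b, F, hF, ha, hb, hab, hdom, hcont, hderiv, hr', rfl⟩
    exact ⟨KZ.of r.toKZ - KZ.of r'.toKZ,
      ⟨n, r.toKZ, r'.toKZ, a, b, F, hF, ha, hb, hab, hdom, hcont, hderiv, hr', rfl⟩,
      by simp only [map_sub, equivKZ_of]; rfl⟩

/-- **`KZ.relations` corresponds to `KZOver.relations ℚ`** under `equivKZ`.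
[Kontsevich–Zagier 2001, §1.2] [cite: KontsevichZagier2001, §1.2] -/
theorem map_equivKZ_relations : KZ.relations.map equivKZ.toAddMonoidHom = relations ℚ := by
  rw [KZ.relations, AddMonoidHom.map_closure, relations]
  congr 1
  simp only [AddEquiv.coe_toAddMonoidHom, image_union, image_equivKZ_domainAddRel,
    image_equivKZ_integrandAddRel, image_equivKZ_changeOfVariablesRel,
    image_equivKZ_newtonLeibnizRel]

/-- Membership form of `map_equivKZ_relations`: `equivKZ c` is a relation over `ℚ` iff `c` is a KZ
relation. [Kontsevich–Zagier 2001, §1.2] [cite: KontsevichZagier2001, §1.2] -/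
theorem equivKZ_mem_relations_iff (c : KZ.FormalRep) : equivKZ c ∈ relations ℚ ↔ c ∈ KZ.relations := by
  rw [← map_equivKZ_relations]
  constructor
  · rintro ⟨c', hc', h⟩
    rwa [← equivKZ.injective h]
  · exact fun hc => AddSubgroup.mem_map_of_mem _ hc

/-- **Equivalence over `ℚ` is KZ-equivalence**: `Equivalent (ofKZ r) (ofKZ r') ↔ KZ.Equivalent r r'`.
[Kontsevich–Zagier 2001, §1.2] [cite: KontsevichZagier2001, §1.2] -/
theorem equivalent_ofKZ_iff (r : KZ.IntegralRep n) (r' : KZ.IntegralRep m) :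
    Equivalent (IntegralRep.ofKZ r) (IntegralRep.ofKZ r') ↔ KZ.Equivalent r r' := by
  rw [Equivalent, KZ.Equivalent, ← equivKZ_mem_relations_iff, map_sub, equivKZ_of, equivKZ_of]

/-- From KZ's calculus to the calculus over any `k`: `IntegralRep.ofKZ` followed by base change
`ℚ → k` (the algebra map `ℚ → k → ℝ` is automatically a scalar tower for a `ℚ`-algebra `k`). With
`k = ℝ`: the inclusion `KZ_ℚ ⊆ KZ_ℝ`. [Kontsevich–Zagier 2001, §1.1; Cresson–Viu-Sos 2022, §1] [cite: KontsevichZagier2001, §1.1] -/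
abbrev IntegralRep.ofKZOver (k : Type*) [CommRing k] [Algebra k ℝ] [Algebra ℚ k] [IsScalarTower ℚ k ℝ]
    (r : KZ.IntegralRep n) : IntegralRep k n :=
  (IntegralRep.ofKZ r).baseChange k

/-- KZ-equivalent representations are equivalent over every `k` above `ℚ` (in particular over `ℝ`).
[Kontsevich–Zagier 2001, §1.2] [cite: KontsevichZagier2001, §1.2] -/
theorem Equivalent.ofKZOver (k : Type*) [CommRing k] [Algebra k ℝ] [Algebra ℚ k] [IsScalarTower ℚ k ℝ]
    {r : KZ.IntegralRep n} {r' : KZ.IntegralRep m} (h : KZ.Equivalent r r') :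
    Equivalent (IntegralRep.ofKZOver k r) (IntegralRep.ofKZOver k r') :=
  ((equivalent_ofKZ_iff r r').mpr h).baseChange k

/-! ### The raw encoding over `ℝ` (route RealPeriodGerms' inline `Adm` / `gen` / `Rel`) -/

namespace Raw

/-- *Admissibility* of a raw pair `(σ, f)` in dimension `n`: `σ` is real semialgebraic, `f` is a
real semialgebraic function on `σ`, and `f` is absolutely integrable on `σ` — i.e. `(σ, f)` are the
two data fields of some `IntegralRep ℝ n`. Verbatim the `let Adm` of route RealPeriodGerms.
[Kontsevich–Zagier 2001, §1.1; Cresson–Viu-Sos 2022, §1] [cite: KontsevichZagier2001, §1.1] -/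
def Adm : (n : ℕ) → Set (Fin n → ℝ) → ((Fin n → ℝ) → ℝ) → Prop := fun n σ f =>
  Literature.ModelTheory.ExponentialFields.IsSemialgebraic ℝ σ ∧
    Literature.NumberTheory.Transcendental.IsSemialgebraicFunOn ℝ σ f ∧ MeasureTheory.IntegrableOn f σ

/-- The generator `[(σ, f)]` of the free abelian group on ALL raw pairs (no admissibility asked).
Verbatim the `let gen` of route RealPeriodGerms. [Kontsevich–Zagier 2001, §1.2] [cite: KontsevichZagier2001, §1.2] -/
def gen : (n : ℕ) → Set (Fin n → ℝ) → ((Fin n → ℝ) → ℝ) →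
    FreeAbelianGroup (Σ n : ℕ, Set (Fin n → ℝ) × ((Fin n → ℝ) → ℝ)) := fun n σ f =>
  FreeAbelianGroup.of ⟨n, (σ, f)⟩

/-- Raw move (1a), additivity in the domain, with admissibility of the three pairs as side
conditions. [Kontsevich–Zagier 2001, §1.2, rule (1)] [cite: KontsevichZagier2001, §1.2 rule (1)] -/
def domainAddSet : Set (FreeAbelianGroup (Σ n : ℕ, Set (Fin n → ℝ) × ((Fin n → ℝ) → ℝ))) :=
  {c | ∃ (n : ℕ) (σ σ₁ σ₂ : Set (Fin n → ℝ)) (f f₁ f₂ : (Fin n → ℝ) → ℝ), Adm n σ f ∧ Adm n σ₁ f₁ ∧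
    Adm n σ₂ f₂ ∧ σ = σ₁ ∪ σ₂ ∧ MeasureTheory.volume (σ₁ ∩ σ₂) = 0 ∧ Set.EqOn f f₁ σ₁ ∧
    Set.EqOn f f₂ σ₂ ∧ c = gen n σ f - gen n σ₁ f₁ - gen n σ₂ f₂}

/-- Raw move (1b), additivity in the integrand, with admissibility side conditions.
[Kontsevich–Zagier 2001, §1.2, rule (1)] [cite: KontsevichZagier2001, §1.2 rule (1)] -/
def integrandAddSet : Set (FreeAbelianGroup (Σ n : ℕ, Set (Fin n → ℝ) × ((Fin n → ℝ) → ℝ))) :=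
  {c | ∃ (n : ℕ) (σ : Set (Fin n → ℝ)) (f f₁ f₂ : (Fin n → ℝ) → ℝ), Adm n σ f ∧ Adm n σ f₁ ∧
    Adm n σ f₂ ∧ Set.EqOn f (f₁ + f₂) σ ∧ c = gen n σ f - gen n σ f₁ - gen n σ f₂}

/-- Raw move (2), change of variables, with admissibility side conditions.
[Kontsevich–Zagier 2001, §1.2, rule (2)] [cite: KontsevichZagier2001, §1.2 rule (2)] -/
def changeOfVariablesSet : Set (FreeAbelianGroup (Σ n : ℕ, Set (Fin n → ℝ) × ((Fin n → ℝ) → ℝ))) :=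
  {c | ∃ (n : ℕ) (σ σ' : Set (Fin n → ℝ)) (f f' : (Fin n → ℝ) → ℝ) (Φ : (Fin n → ℝ) → (Fin n → ℝ))
      (Φ' : (Fin n → ℝ) → (Fin n → ℝ) →L[ℝ] (Fin n → ℝ)), Adm n σ f ∧ Adm n σ' f' ∧
    Literature.NumberTheory.Transcendental.IsSemialgebraicMapOn ℝ σ Φ ∧
    (∀ x ∈ σ, HasFDerivWithinAt Φ (Φ' x) σ x) ∧ Set.InjOn Φ σ ∧ σ' = Φ '' σ ∧
    (∀ x ∈ σ, f x = f' (Φ x) * |(Φ' x).det|) ∧ c = gen n σ f - gen n σ' f'}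

/-- Raw move (3), Newton–Leibniz along the last coordinate, with admissibility side conditions.
[Kontsevich–Zagier 2001, §1.2, rule (3)] [cite: KontsevichZagier2001, §1.2 rule (3)] -/
def newtonLeibnizSet : Set (FreeAbelianGroup (Σ n : ℕ, Set (Fin n → ℝ) × ((Fin n → ℝ) → ℝ))) :=
  {c | ∃ (n : ℕ) (σ : Set (Fin (n + 1) → ℝ)) (f : (Fin (n + 1) → ℝ) → ℝ) (τ : Set (Fin n → ℝ))
      (g a b : (Fin n → ℝ) → ℝ) (F : (Fin (n + 1) → ℝ) → ℝ), Adm (n + 1) σ f ∧ Adm n τ g ∧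
    Literature.NumberTheory.Transcendental.IsSemialgebraicFunOn ℝ σ F ∧
    Literature.NumberTheory.Transcendental.IsSemialgebraicFunOn ℝ τ a ∧
    Literature.NumberTheory.Transcendental.IsSemialgebraicFunOn ℝ τ b ∧ (∀ x ∈ τ, a x ≤ b x) ∧
    σ = {z | (Fin.init z : Fin n → ℝ) ∈ τ ∧ a (Fin.init z) ≤ z (Fin.last n) ∧
      z (Fin.last n) ≤ b (Fin.init z)} ∧
    (∀ x ∈ τ, ContinuousOn (fun t : ℝ => F (Fin.snoc x t)) (Set.Icc (a x) (b x))) ∧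
    (∀ x ∈ τ, ∀ t ∈ Set.Ioo (a x) (b x),
      HasDerivAt (fun s : ℝ => F (Fin.snoc x s)) (f (Fin.snoc x t)) t) ∧
    (∀ x ∈ τ, g x = F (Fin.snoc x (b x)) - F (Fin.snoc x (a x))) ∧ c = gen (n + 1) σ f - gen n τ g}

/-- The subgroup `Rel` of the free abelian group on raw pairs generated by the four real-coefficient
moves with admissibility side conditions. Unfolding `domainAddSet`, …, `newtonLeibnizSet`, `Adm`,
`gen`, this is verbatim the `let Rel` of route RealPeriodGerms (items GermSound, RealTransfer,
GermComplete, NotNaiveRealKZ, Assembly), so those items can be restated over `KZOver` by `rfl`.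
[Kontsevich–Zagier 2001, §1.2] [cite: KontsevichZagier2001, §1.2] -/
def Rel : AddSubgroup (FreeAbelianGroup (Σ n : ℕ, Set (Fin n → ℝ) × ((Fin n → ℝ) → ℝ))) :=
  AddSubgroup.closure (domainAddSet ∪ integrandAddSet ∪ changeOfVariablesSet ∪ newtonLeibnizSet)

/-- The span of the admissible generators inside the free abelian group on all raw pairs.
[Kontsevich–Zagier 2001, §1.2] [cite: KontsevichZagier2001, §1.2] -/
def admissibleSpan : AddSubgroup (FreeAbelianGroup (Σ n : ℕ, Set (Fin n → ℝ) × ((Fin n → ℝ) → ℝ))) :=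
  AddSubgroup.closure {c | ∃ (n : ℕ) (σ : Set (Fin n → ℝ)) (f : (Fin n → ℝ) → ℝ),
    Adm n σ f ∧ c = gen n σ f}

end Raw

/-- Every integral representation over `ℝ` has an admissible raw pair. [Kontsevich–Zagier 2001, §1.1] [cite: KontsevichZagier2001, §1.1] -/
theorem IntegralRep.adm (r : IntegralRep ℝ n) : Raw.Adm n r.domain r.integrand :=
  ⟨r.isSemialgebraic_domain, r.isSemialgebraicFunOn_integrand, r.integrableOn⟩

/-- The integral representation over `ℝ` attached to an admissible raw pair.
[Kontsevich–Zagier 2001, §1.1] [cite: KontsevichZagier2001, §1.1] -/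
def IntegralRep.ofAdm {σ : Set (Fin n → ℝ)} {f : (Fin n → ℝ) → ℝ} (h : Raw.Adm n σ f) :
    IntegralRep ℝ n :=
  ⟨σ, f, h.1, h.2.1, h.2.2⟩

/-- `ofAdm` has the given domain. [Kontsevich–Zagier 2001, §1.1] [cite: KontsevichZagier2001, §1.1] -/
@[simp] lemma IntegralRep.domain_ofAdm {σ : Set (Fin n → ℝ)} {f : (Fin n → ℝ) → ℝ}
    (h : Raw.Adm n σ f) : (IntegralRep.ofAdm h).domain = σ := rfl

/-- `ofAdm` has the given integrand. [Kontsevich–Zagier 2001, §1.1] [cite: KontsevichZagier2001, §1.1] -/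
@[simp] lemma IntegralRep.integrand_ofAdm {σ : Set (Fin n → ℝ)} {f : (Fin n → ℝ) → ℝ}
    (h : Raw.Adm n σ f) : (IntegralRep.ofAdm h).integrand = f := rfl

/-- `ofAdm` of the raw pair of `r` is `r` (proof irrelevance). [Kontsevich–Zagier 2001, §1.1] [cite: KontsevichZagier2001, §1.1] -/
@[simp] lemma IntegralRep.ofAdm_adm (r : IntegralRep ℝ n) : IntegralRep.ofAdm r.adm = r := rfl

/-- **The raw encoding** `FormalRep ℝ →+ (free abelian group on raw pairs)`: forget the three
proof fields of each generator, `[r] ↦ [(r.domain, r.integrand)]`. [Kontsevich–Zagier 2001, §1.2] [cite: KontsevichZagier2001, §1.2] -/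
def toRaw : FormalRep ℝ →+ FreeAbelianGroup (Σ n : ℕ, Set (Fin n → ℝ) × ((Fin n → ℝ) → ℝ)) :=
  FreeAbelianGroup.map fun r => ⟨r.1, (r.2.domain, r.2.integrand)⟩

/-- `toRaw` of a generator is the raw generator of its pair. [Kontsevich–Zagier 2001, §1.2] [cite: KontsevichZagier2001, §1.2] -/
@[simp] theorem toRaw_of (r : IntegralRep ℝ n) : toRaw (of r) = Raw.gen n r.domain r.integrand :=
  rfl

/-- `toRaw` of the generator of an admissible pair. [Kontsevich–Zagier 2001, §1.2] [cite: KontsevichZagier2001, §1.2] -/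
theorem toRaw_of_ofAdm {σ : Set (Fin n → ℝ)} {f : (Fin n → ℝ) → ℝ} (h : Raw.Adm n σ f) :
    toRaw (of (IntegralRep.ofAdm h)) = Raw.gen n σ f :=
  rfl

open Classical in
/-- A left inverse of `toRaw`: an admissible raw generator goes to the generator of its integral
representation, a non-admissible one to `0`. [Kontsevich–Zagier 2001, §1.2] [cite: KontsevichZagier2001, §1.2] -/
def ofRaw : FreeAbelianGroup (Σ n : ℕ, Set (Fin n → ℝ) × ((Fin n → ℝ) → ℝ)) →+ FormalRep ℝ :=
  FreeAbelianGroup.lift fun g =>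
    if h : Raw.Adm g.1 g.2.1 g.2.2 then of (IntegralRep.ofAdm h) else 0

/-- `ofRaw` on an admissible raw generator. [Kontsevich–Zagier 2001, §1.2] [cite: KontsevichZagier2001, §1.2] -/
theorem ofRaw_gen {σ : Set (Fin n → ℝ)} {f : (Fin n → ℝ) → ℝ} (h : Raw.Adm n σ f) :
    ofRaw (Raw.gen n σ f) = of (IntegralRep.ofAdm h) := by
  simp only [ofRaw, Raw.gen, FreeAbelianGroup.lift_apply_of]
  rw [dif_pos h]

/-- `ofRaw` is a left inverse of `toRaw`. [Kontsevich–Zagier 2001, §1.2] [cite: KontsevichZagier2001, §1.2] -/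
@[simp] theorem ofRaw_toRaw (c : FormalRep ℝ) : ofRaw (toRaw c) = c := by
  have h : ofRaw.comp toRaw = AddMonoidHom.id _ :=
    FreeAbelianGroup.lift_ext _ _ fun ⟨n, r⟩ => by
      simp only [AddMonoidHom.coe_comp, Function.comp_apply, AddMonoidHom.id_apply]
      exact (congrArg ofRaw (toRaw_of r)).trans (ofRaw_gen r.adm)
  exact DFunLike.congr_fun h c

/-- **`toRaw` is injective** (an integral representation is determined by its raw pair, by proof
irrelevance). [Kontsevich–Zagier 2001, §1.2] [cite: KontsevichZagier2001, §1.2] -/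
theorem toRaw_injective : Function.Injective toRaw :=
  Function.LeftInverse.injective ofRaw_toRaw

/-- `toRaw` carries the domain-additivity move onto the raw domain-additivity move.
[Kontsevich–Zagier 2001, §1.2] [cite: KontsevichZagier2001, §1.2] -/
theorem image_toRaw_domainAddRel : toRaw '' domainAddRel ℝ = Raw.domainAddSet := by
  ext c
  constructor
  · rintro ⟨_, ⟨n, r, r₁, r₂, hdom, hnull, h₁, h₂, rfl⟩, rfl⟩
    exact ⟨n, r.domain, r₁.domain, r₂.domain, r.integrand, r₁.integrand, r₂.integrand, r.adm, r₁.adm,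
      r₂.adm, hdom, hnull, h₁, h₂, by simp only [map_sub, toRaw_of]⟩
  · rintro ⟨n, σ, σ₁, σ₂, f, f₁, f₂, h, h₁', h₂', hdom, hnull, h₁, h₂, rfl⟩
    exact ⟨of (.ofAdm h) - of (.ofAdm h₁') - of (.ofAdm h₂'),
      ⟨n, .ofAdm h, .ofAdm h₁', .ofAdm h₂', hdom, hnull, h₁, h₂, rfl⟩, by simp only [map_sub]; rfl⟩

/-- `toRaw` carries the integrand-additivity move onto the raw integrand-additivity move.
[Kontsevich–Zagier 2001, §1.2] [cite: KontsevichZagier2001, §1.2] -/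
theorem image_toRaw_integrandAddRel : toRaw '' integrandAddRel ℝ = Raw.integrandAddSet := by
  ext c
  constructor
  · rintro ⟨_, ⟨n, r, r₁, r₂, h₁, h₂, hadd, rfl⟩, rfl⟩
    refine ⟨n, r.domain, r.integrand, r₁.integrand, r₂.integrand, r.adm, h₁ ▸ r₁.adm, h₂ ▸ r₂.adm,
      hadd, ?_⟩
    simp only [map_sub, toRaw_of, h₁, h₂]
  · rintro ⟨n, σ, f, f₁, f₂, h, h₁', h₂', hadd, rfl⟩
    exact ⟨of (.ofAdm h) - of (.ofAdm h₁') - of (.ofAdm h₂'),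
      ⟨n, .ofAdm h, .ofAdm h₁', .ofAdm h₂', rfl, rfl, hadd, rfl⟩, by simp only [map_sub]; rfl⟩

/-- `toRaw` carries the change-of-variables move onto the raw change-of-variables move.
[Kontsevich–Zagier 2001, §1.2] [cite: KontsevichZagier2001, §1.2] -/
theorem image_toRaw_changeOfVariablesRel :
    toRaw '' changeOfVariablesRel ℝ = Raw.changeOfVariablesSet := by
  ext c
  constructor
  · rintro ⟨_, ⟨n, r, r', Φ, Φ', hΦ, hΦ', hinj, hdom, hf, rfl⟩, rfl⟩
    exact ⟨n, r.domain, r'.domain, r.integrand, r'.integrand, Φ, Φ', r.adm, r'.adm, hΦ, hΦ', hinj,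
      hdom, hf, by simp only [map_sub, toRaw_of]⟩
  · rintro ⟨n, σ, σ', f, f', Φ, Φ', h, h', hΦ, hΦ', hinj, hdom, hf, rfl⟩
    exact ⟨of (.ofAdm h) - of (.ofAdm h'),
      ⟨n, .ofAdm h, .ofAdm h', Φ, Φ', hΦ, hΦ', hinj, hdom, hf, rfl⟩, by simp only [map_sub]; rfl⟩

/-- `toRaw` carries the Newton–Leibniz move onto the raw Newton–Leibniz move.
[Kontsevich–Zagier 2001, §1.2] [cite: KontsevichZagier2001, §1.2] -/
theorem image_toRaw_newtonLeibnizRel : toRaw '' newtonLeibnizRel ℝ = Raw.newtonLeibnizSet := by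
  ext c
  constructor
  · rintro ⟨_, ⟨n, r, r', a, b, F, hF, ha, hb, hab, hdom, hcont, hderiv, hr', rfl⟩, rfl⟩
    exact ⟨n, r.domain, r.integrand, r'.domain, r'.integrand, a, b, F, r.adm, r'.adm, hF, ha, hb, hab,
      hdom, hcont, hderiv, hr', by simp only [map_sub, toRaw_of]⟩
  · rintro ⟨n, σ, f, τ, g, a, b, F, h, h', hF, ha, hb, hab, hdom, hcont, hderiv, hr', rfl⟩
    exact ⟨of (.ofAdm h) - of (.ofAdm h'),
      ⟨n, .ofAdm h, .ofAdm h', a, b, F, hF, ha, hb, hab, hdom, hcont, hderiv, hr', rfl⟩,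
      by simp only [map_sub]; rfl⟩

/-- **`toRaw` carries `relations ℝ` onto `Raw.Rel`.** [Kontsevich–Zagier 2001, §1.2] [cite: KontsevichZagier2001, §1.2] -/
theorem map_toRaw_relations : (relations ℝ).map toRaw = Raw.Rel := by
  rw [relations, AddMonoidHom.map_closure, Raw.Rel]
  congr 1
  simp only [image_union, image_toRaw_domainAddRel, image_toRaw_integrandAddRel,
    image_toRaw_changeOfVariablesRel, image_toRaw_newtonLeibnizRel]

/-- **Relations over `ℝ` are detected in the raw encoding**: `c ∈ relations ℝ ↔ toRaw c ∈ Raw.Rel`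
(`map_toRaw_relations` and injectivity of `toRaw`). [Kontsevich–Zagier 2001, §1.2] [cite: KontsevichZagier2001, §1.2] -/
theorem mem_relations_iff_toRaw_mem (c : FormalRep ℝ) : c ∈ relations ℝ ↔ toRaw c ∈ Raw.Rel := by
  rw [← map_toRaw_relations]
  constructor
  · exact fun hc => AddSubgroup.mem_map_of_mem _ hc
  · rintro ⟨c', hc', h⟩
    rwa [← toRaw_injective h]

/-- The range of `toRaw` is the span of the admissible generators. [Kontsevich–Zagier 2001, §1.2] [cite: KontsevichZagier2001, §1.2] -/
theorem range_toRaw : toRaw.range = Raw.admissibleSpan := by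
  apply le_antisymm
  · rintro _ ⟨c, rfl⟩
    induction c using FreeAbelianGroup.induction_on with
    | zero => simp only [map_zero]; exact Raw.admissibleSpan.zero_mem
    | of x =>
      obtain ⟨n, r⟩ := x
      exact AddSubgroup.subset_closure ⟨n, r.domain, r.integrand, r.adm, rfl⟩
    | neg x hx => simpa only [map_neg] using Raw.admissibleSpan.neg_mem hx
    | add x y hx hy => simpa only [map_add] using Raw.admissibleSpan.add_mem hx hy
  · refine (AddSubgroup.closure_le _).mpr ?_
    rintro _ ⟨n, σ, f, h, rfl⟩
    exact ⟨of (.ofAdm h), rfl⟩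

/-- `Raw.Rel` lies in the span of the admissible generators (every raw move has admissible
entries), so `Raw.Rel ∩ admissibleSpan = Raw.Rel = toRaw (relations ℝ)`. [Kontsevich–Zagier 2001, §1.2] [cite: KontsevichZagier2001, §1.2] -/
theorem Raw.Rel_le_admissibleSpan : Raw.Rel ≤ Raw.admissibleSpan := by
  rw [← map_toRaw_relations, ← range_toRaw]
  exact AddSubgroup.map_le_range _ _

/-- **Comparison lemma (generators).** For integral representations `r`, `r'` over `ℝ`:
`gen r − gen r' ∈ Raw.Rel ↔ Equivalent r r'` (i.e. `of r − of r' ∈ relations ℝ`).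
[Kontsevich–Zagier 2001, §1.2] [cite: KontsevichZagier2001, §1.2] -/
theorem Raw.gen_sub_gen_mem_Rel_iff_equivalent (r : IntegralRep ℝ n) (r' : IntegralRep ℝ m) :
    Raw.gen n r.domain r.integrand - Raw.gen m r'.domain r'.integrand ∈ Raw.Rel ↔ Equivalent r r' := by
  rw [Equivalent, mem_relations_iff_toRaw_mem, map_sub, toRaw_of, toRaw_of]

/-- **Comparison lemma (admissible pairs).** For admissible raw pairs `(σ, f)`, `(σ', f')`:
`gen n σ f − gen m σ' f' ∈ Raw.Rel ↔ of (ofAdm h) − of (ofAdm h') ∈ relations ℝ`. This is the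
lemma by which the items of route RealPeriodGerms (stated with the inline `Adm`/`gen`/`Rel`) are
restated over `KZOver ℝ` without change of meaning. [Kontsevich–Zagier 2001, §1.2] [cite: KontsevichZagier2001, §1.2] -/
theorem Raw.gen_sub_gen_mem_Rel_iff {σ : Set (Fin n → ℝ)} {f : (Fin n → ℝ) → ℝ}
    {σ' : Set (Fin m → ℝ)} {f' : (Fin m → ℝ) → ℝ} (h : Raw.Adm n σ f) (h' : Raw.Adm m σ' f') :
    Raw.gen n σ f - Raw.gen m σ' f' ∈ Raw.Rel ↔
      of (IntegralRep.ofAdm h) - of (IntegralRep.ofAdm h') ∈ relations ℝ :=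
  Raw.gen_sub_gen_mem_Rel_iff_equivalent (IntegralRep.ofAdm h) (IntegralRep.ofAdm h')

/-- **Comparison lemma (KZ representations).** For KZ representations `r`, `r'` (`ℚ`-data, as in
items RealTransfer / Assembly of route RealPeriodGerms): `gen r − gen r' ∈ Raw.Rel` iff the real
base changes of `r`, `r'` are equivalent over `ℝ`. [Kontsevich–Zagier 2001, §1.2] [cite: KontsevichZagier2001, §1.2] -/
theorem Raw.gen_sub_gen_mem_Rel_iff_kz (r : KZ.IntegralRep n) (r' : KZ.IntegralRep m) :
    Raw.gen n r.domain r.integrand - Raw.gen m r'.domain r'.integrand ∈ Raw.Rel ↔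
      Equivalent (IntegralRep.ofKZOver ℝ r) (IntegralRep.ofKZOver ℝ r') :=
  Raw.gen_sub_gen_mem_Rel_iff_equivalent (IntegralRep.ofKZOver ℝ r) (IntegralRep.ofKZOver ℝ r')

/-- Soundness in the raw encoding: a difference of admissible generators lying in `Raw.Rel` has
equal integrals. [Kontsevich–Zagier 2001, §1.2] [cite: KontsevichZagier2001, §1.2] -/
theorem Raw.integral_eq_of_gen_sub_gen_mem_Rel {σ : Set (Fin n → ℝ)} {f : (Fin n → ℝ) → ℝ}
    {σ' : Set (Fin m → ℝ)} {f' : (Fin m → ℝ) → ℝ} (h : Raw.Adm n σ f) (h' : Raw.Adm m σ' f')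
    (hrel : Raw.gen n σ f - Raw.gen m σ' f' ∈ Raw.Rel) :
    ∫ x in σ, f x = ∫ y in σ', f' y :=
  Equivalent.value_eq
    ((Raw.gen_sub_gen_mem_Rel_iff_equivalent (IntegralRep.ofAdm h) (IntegralRep.ofAdm h')).mp hrel)

end KZOver

end Literature.NumberTheory.Transcendental
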